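import Summits.ValiantsHypothesis.ValiantsHypothesis.Theorems.BarrierLeverAnchoredDoorHitsLowerPairsSplitGeneralRowSums

/-!
# Support item `AnchoredDoorHitsLowerPairs` (stmt-ValiantsHypothesis-22510), line `anchored-peeling`:
# CONJECTURE SP for all `m` — part 8: THE LIMIT DESIGN IS A BASIS (columns of the leading matrix are independent)

Helper file (`--supports stmt-ValiantsHypothesis-22510`; cell valiant-natproofs, rung V4, 𝒟-side door (c); registered line
`Cruxes/AnchoredDoorHitsLowerPairs/Lines/anchored_peeling.lean` v24, registered stub `stub_splitFamilyGe3`; prover seat val-np-p1 gen 24;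
memo HOME/val-np-p1/g24/MEMO-SP-proof-valnp1-g24.md §2.2–2.5, §6 B3). Closes NO item.

WHAT. `topCol_indep`: if a combination `Σ_E g E · topCol m E` of the limit columns of the split pair vanishes at every row of the `(2m+2)`-cube, then
`g = 0` on every face. Proof: the rows without `α` kill the `∅`/independent/mixed coefficients and express the vertex coefficients through the splittings
(`…SplitGeneralRowSums`); the rows with `α` (`rowSum_alpha`) produce exactly the core system `CoreSys` of `…SplitGeneralCore` with the weights
`r t = cw m (insert m t) = enc t + 2` (nonzero, pairwise distinct), whose unknowns all vanish (`CoreSys.all_zero`).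

WHAT THIS IS NOT: nothing on crux stmt-ValiantsHypothesis-14610 or on `VP` versus `VNP`.
-/

set_option linter.dupNamespace false

namespace Summit.ValiantsHypothesis.ValiantsHypothesis.Theorems.BarrierLever.AnchoredPeeling

namespace SplitGeneral

open Finset DecFamily

variable {m : ℕ}

/-! ## 1. Rows with `α` -/

/-- **Rows with `α`** (assuming the mixed coefficients `gvu P t`, `P ≠ ∅`, already vanish). -/
theorem rowSum_alpha (g : Finset ℕ → ℂ) (hvu : ∀ P ∈ cliqueSets m, P ≠ ∅ → ∀ t ∈ smallSets m, gvu m g P t = 0)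
    {S T : Finset ℕ} (hS : S ⊆ range (m + 1)) (hT : T ⊆ range m) :
    ∑ E ∈ codeFaces m, g E * topCol m E (rowC m S true T) =
      (ind (S = ∅ ∧ T = ∅) * (g1 g ∅ + g1 g {m}) + ind (S = ∅ ∧ T ≠ ∅) * (g1 g {m} + g1 g T + (cw m (insert m T) : ℂ) * g1 g (insert m T)) +
        ind (S = {m} ∧ T ≠ ∅) * g1 g T) +
      (ind (S ≠ ∅ ∧ T = ∅) * (g2 g S ∅ + g2 g S {m}) + ind (S ≠ ∅ ∧ T ≠ ∅) * (g2 g S {m} + g2 g S T + (cw m (insert m T) : ℂ) * g2 g S (insert m T)) +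
        ind (m ∈ S ∧ S.erase m ≠ ∅ ∧ T ≠ ∅) * g2 g (S.erase m) T) +
      ind (S = ∅ ∧ T ≠ ∅) * gvu m g ∅ T := by
  classical
  rw [rowSum_eq g hS hT]
  have ht : ind (true = true) = 1 := ind_true rfl
  -- term 0 and term 2 vanish
  rw [ind_false (show ¬ (S = ∅ ∧ true = false ∧ T = ∅) from fun h => Bool.noConfusion h.2.1), mul_zero, zero_add,
    Finset.sum_eq_zero (s := smallSets m) (fun t _ => by
      rw [ind_false (show ¬ (S = ∅ ∧ true = false ∧ T = t) from fun h => Bool.noConfusion h.2.1), mul_zero]), add_zero]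
  -- term 1
  have e1 : ∑ P ∈ cliqueSets m, g1 g P * (ind (P ≠ ∅ ∧ S = P ∧ true = false ∧ T = ∅) + ind (true = true) * aco m P S T) =
      ∑ P ∈ cliqueSets m, g1 g P * aco m P S T :=
    Finset.sum_congr rfl (fun P _ => by
      rw [ind_false (show ¬ (P ≠ ∅ ∧ S = P ∧ true = false ∧ T = ∅) from fun h => Bool.noConfusion h.2.2.1), ht, one_mul, zero_add])
  rw [e1, aco_sum (g1 g) hT]
  -- term 3: increasing pairs → ordered pairs → full double sum
  set G : Finset ℕ → Finset ℕ → ℂ := fun P P' => g2 g P P' * ind (P ≠ ∅ ∧ P ⊆ S) * aco m P' (S \ P) T with hG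
  have e3 : ∑ pp ∈ ltPairs m, g {enc pp.1, enc pp.2} *
      (ind (pp.1 ≠ ∅ ∧ pp.2 ≠ ∅ ∧ Disjoint pp.1 pp.2 ∧ S = pp.1 ∪ pp.2 ∧ true = false ∧ T = ∅) +
        ind (true = true) * (ind (pp.1 ≠ ∅ ∧ pp.1 ⊆ S) * aco m pp.2 (S \ pp.1) T + ind (pp.2 ≠ ∅ ∧ pp.2 ⊆ S) * aco m pp.1 (S \ pp.2) T)) =
      ∑ P ∈ cliqueSets m, ind (P ≠ ∅ ∧ P ⊆ S) * ∑ P' ∈ cliqueSets m, g2 g P P' * aco m P' (S \ P) T := by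
    have step1 : ∀ pp ∈ ltPairs m, g {enc pp.1, enc pp.2} *
        (ind (pp.1 ≠ ∅ ∧ pp.2 ≠ ∅ ∧ Disjoint pp.1 pp.2 ∧ S = pp.1 ∪ pp.2 ∧ true = false ∧ T = ∅) +
          ind (true = true) * (ind (pp.1 ≠ ∅ ∧ pp.1 ⊆ S) * aco m pp.2 (S \ pp.1) T + ind (pp.2 ≠ ∅ ∧ pp.2 ⊆ S) * aco m pp.1 (S \ pp.2) T)) =
        G pp.1 pp.2 + G pp.2 pp.1 := by
      intro pp hpp
      have hne : pp.1 ≠ pp.2 := fun h => lt_irrefl _ (h ▸ (mem_ltPairs.mp hpp).2.2)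
      rw [ind_false (show ¬ (pp.1 ≠ ∅ ∧ pp.2 ≠ ∅ ∧ Disjoint pp.1 pp.2 ∧ S = pp.1 ∪ pp.2 ∧ true = false ∧ T = ∅) from
        fun h => Bool.noConfusion h.2.2.2.2.1), zero_add, ht, one_mul]
      show _ = g2 g pp.1 pp.2 * _ * _ + g2 g pp.2 pp.1 * _ * _
      rw [g2_of_ne g hne, g2_of_ne g hne.symm, Finset.pair_comm (enc pp.2)]
      ring
    rw [Finset.sum_congr rfl step1, sum_pairs_lt]
    -- the diagonal of `G` vanishes, so the off-diagonal sum is the full product sum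
    have step2 : ∑ pp ∈ (cliqueSets m ×ˢ cliqueSets m).filter (fun pp => pp.1 ≠ pp.2), G pp.1 pp.2 =
        ∑ pp ∈ cliqueSets m ×ˢ cliqueSets m, G pp.1 pp.2 := by
      rw [Finset.sum_filter]
      refine Finset.sum_congr rfl (fun pp _ => ?_)
      by_cases h : pp.1 ≠ pp.2
      · rw [if_pos h]
      · rw [if_neg h]; show 0 = g2 g pp.1 pp.2 * _ * _; rw [g2, if_pos (not_not.mp h)]; ring
    rw [step2, Finset.sum_product]
    refine Finset.sum_congr rfl (fun P _ => ?_)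
    rw [Finset.mul_sum]
    exact Finset.sum_congr rfl (fun P' _ => by show g2 g P P' * _ * _ = _; ring)
  rw [e3]
  -- close the inner sums with `aco_sum` and collapse the outer sum
  have e3' : ∑ P ∈ cliqueSets m, ind (P ≠ ∅ ∧ P ⊆ S) * ∑ P' ∈ cliqueSets m, g2 g P P' * aco m P' (S \ P) T =
      ind (S ≠ ∅ ∧ T = ∅) * (g2 g S ∅ + g2 g S {m}) + ind (S ≠ ∅ ∧ T ≠ ∅) * (g2 g S {m} + g2 g S T + (cw m (insert m T) : ℂ) * g2 g S (insert m T)) +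
        ind (m ∈ S ∧ S.erase m ≠ ∅ ∧ T ≠ ∅) * g2 g (S.erase m) T := by
    have hval : ∀ P ∈ cliqueSets m, ind (P ≠ ∅ ∧ P ⊆ S) * ∑ P' ∈ cliqueSets m, g2 g P P' * aco m P' (S \ P) T =
        (ind (S ≠ ∅ ∧ T = ∅) * (g2 g P ∅ + g2 g P {m}) + ind (S ≠ ∅ ∧ T ≠ ∅) * (g2 g P {m} + g2 g P T + (cw m (insert m T) : ℂ) * g2 g P (insert m T))) *
            ind (P = S) +
          (ind (m ∈ S ∧ S.erase m ≠ ∅ ∧ T ≠ ∅) * g2 g P T) * ind (P = S.erase m) := by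
      intro P _
      rw [aco_sum (g2 g P) hT]
      have i1 : ind (P ≠ ∅ ∧ P ⊆ S) * ind (S \ P = ∅ ∧ T = ∅) = ind (S ≠ ∅ ∧ T = ∅) * ind (P = S) := by
        rw [← ind_and, ← ind_and]
        refine ind_congr ⟨fun h => ?_, fun h => ?_⟩
        · have hPS : P = S := Finset.Subset.antisymm h.1.2 (Finset.sdiff_eq_empty_iff_subset.mp h.2.1)
          exact ⟨⟨hPS ▸ h.1.1, h.2.2⟩, hPS⟩
        · exact ⟨⟨h.2.symm ▸ h.1.1, h.2 ▸ subset_rfl⟩, by rw [h.2, Finset.sdiff_self], h.1.2⟩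
      have i2 : ind (P ≠ ∅ ∧ P ⊆ S) * ind (S \ P = ∅ ∧ T ≠ ∅) = ind (S ≠ ∅ ∧ T ≠ ∅) * ind (P = S) := by
        rw [← ind_and, ← ind_and]
        refine ind_congr ⟨fun h => ?_, fun h => ?_⟩
        · have hPS : P = S := Finset.Subset.antisymm h.1.2 (Finset.sdiff_eq_empty_iff_subset.mp h.2.1)
          exact ⟨⟨hPS ▸ h.1.1, h.2.2⟩, hPS⟩
        · exact ⟨⟨h.2.symm ▸ h.1.1, h.2 ▸ subset_rfl⟩, by rw [h.2, Finset.sdiff_self], h.1.2⟩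
      have i3 : ind (P ≠ ∅ ∧ P ⊆ S) * ind (S \ P = {m} ∧ T ≠ ∅) = ind (m ∈ S ∧ S.erase m ≠ ∅ ∧ T ≠ ∅) * ind (P = S.erase m) := by
        rw [← ind_and, ← ind_and]
        refine ind_congr ⟨fun h => ?_, fun h => ?_⟩
        · have hmS : m ∈ S := Finset.sdiff_subset (h.2.1.symm ▸ Finset.mem_singleton_self m)
          have hmP : m ∉ P := fun hmP => by
            have : m ∈ S \ P := h.2.1.symm ▸ Finset.mem_singleton_self m
            exact (Finset.mem_sdiff.mp this).2 hmP
          have hPS : P = S.erase m := by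
            ext x
            rw [Finset.mem_erase]
            constructor
            · intro hx; exact ⟨fun hxm => hmP (hxm ▸ hx), h.1.2 hx⟩
            · rintro ⟨hxm, hxS⟩
              by_contra hxP
              have : x ∈ S \ P := Finset.mem_sdiff.mpr ⟨hxS, hxP⟩
              rw [h.2.1, Finset.mem_singleton] at this
              exact hxm this
          exact ⟨⟨hmS, hPS ▸ h.1.1, h.2.2⟩, hPS⟩
        · obtain ⟨⟨hmS, hne, hT0⟩, hP⟩ := h
          subst hP
          refine ⟨⟨hne, Finset.erase_subset m S⟩, ?_, hT0⟩
          rw [Finset.sdiff_erase_self hmS]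
      calc ind (P ≠ ∅ ∧ P ⊆ S) * (ind (S \ P = ∅ ∧ T = ∅) * (g2 g P ∅ + g2 g P {m}) +
            ind (S \ P = ∅ ∧ T ≠ ∅) * (g2 g P {m} + g2 g P T + (cw m (insert m T) : ℂ) * g2 g P (insert m T)) + ind (S \ P = {m} ∧ T ≠ ∅) * g2 g P T)
          = (ind (P ≠ ∅ ∧ P ⊆ S) * ind (S \ P = ∅ ∧ T = ∅)) * (g2 g P ∅ + g2 g P {m}) +
            (ind (P ≠ ∅ ∧ P ⊆ S) * ind (S \ P = ∅ ∧ T ≠ ∅)) * (g2 g P {m} + g2 g P T + (cw m (insert m T) : ℂ) * g2 g P (insert m T)) +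
            (ind (P ≠ ∅ ∧ P ⊆ S) * ind (S \ P = {m} ∧ T ≠ ∅)) * g2 g P T := by ring
        _ = _ := by rw [i1, i2, i3]; ring
    rw [Finset.sum_congr rfl hval, Finset.sum_add_distrib, sum_mul_ind_eq, sum_mul_ind_eq, if_pos (mem_cliqueSets.mpr hS)]
    by_cases hc : m ∈ S ∧ S.erase m ≠ ∅ ∧ T ≠ ∅
    · rw [if_pos (mem_cliqueSets.mpr ((Finset.erase_subset m S).trans hS))]
    · rw [ind_false hc]; simp
  rw [e3']
  -- term 4: only `P = ∅`, `t = T` survives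
  have e4 : ∑ pt ∈ cliqueSets m ×ˢ smallSets m, gvu m g pt.1 pt.2 *
      (ind (pt.1 ≠ ∅ ∧ S = pt.1 ∧ true = false ∧ T = pt.2) + ind (true = true ∧ pt.2 ⊆ T) * aco m pt.1 S (T \ pt.2)) =
      ind (S = ∅ ∧ T ≠ ∅) * gvu m g ∅ T := by
    have hval : ∀ pt ∈ cliqueSets m ×ˢ smallSets m, gvu m g pt.1 pt.2 *
        (ind (pt.1 ≠ ∅ ∧ S = pt.1 ∧ true = false ∧ T = pt.2) + ind (true = true ∧ pt.2 ⊆ T) * aco m pt.1 S (T \ pt.2)) =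
        (gvu m g ∅ T * ind (S = ∅ ∧ T ≠ ∅)) * ind (pt = (∅, T)) := by
      intro pt hpt
      obtain ⟨h1, h2⟩ := Finset.mem_product.mp hpt
      rw [ind_false (show ¬ (pt.1 ≠ ∅ ∧ S = pt.1 ∧ true = false ∧ T = pt.2) from fun h => Bool.noConfusion h.2.2.1), zero_add]
      by_cases hP0 : pt.1 = ∅
      · rw [hP0]; unfold aco; rw [if_pos rfl, ← mul_assoc, mul_assoc, ← ind_and, mul_assoc, ← ind_and]
        have ht2 := (mem_smallSets.mp h2).2
        by_cases hc : pt = (∅, T)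
        · have h2' : pt.2 = T := congrArg Prod.snd hc
          rw [ind_congr (show ((true = true ∧ pt.2 ⊆ T) ∧ S = ∅ ∧ T \ pt.2 = ∅) ↔ (S = ∅ ∧ T ≠ ∅) from
            ⟨fun h => ⟨h.2.1, h2' ▸ ht2⟩, fun h => ⟨⟨rfl, h2' ▸ subset_rfl⟩, h.1, by rw [h2', Finset.sdiff_self]⟩⟩),
            ind_congr (show ((S = ∅ ∧ T ≠ ∅) ∧ pt = (∅, T)) ↔ (S = ∅ ∧ T ≠ ∅) from ⟨fun h => h.1, fun h => ⟨h, hc⟩⟩), h2']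
        · have hne : ¬ ((true = true ∧ pt.2 ⊆ T) ∧ S = ∅ ∧ T \ pt.2 = ∅) := by
            rintro ⟨⟨-, hsub⟩, -, hsd⟩
            apply hc
            exact Prod.ext hP0 (Finset.Subset.antisymm hsub (Finset.sdiff_eq_empty_iff_subset.mp hsd))
          rw [ind_false hne, ind_false (show ¬ ((S = ∅ ∧ T ≠ ∅) ∧ pt = (∅, T)) from fun h => hc h.2), mul_zero, mul_zero]
      · rw [hvu pt.1 h1 hP0 pt.2 h2, zero_mul, ind_false (show ¬ pt = (∅, T) from fun h => hP0 (congrArg Prod.fst h)), mul_zero]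
    rw [Finset.sum_congr rfl hval, sum_mul_ind_eq]
    by_cases hc : S = ∅ ∧ T ≠ ∅
    · rw [if_pos (Finset.mem_product.mpr ⟨mem_cliqueSets.mpr (Finset.empty_subset _), mem_smallSets.mpr ⟨hT, hc.2⟩⟩), mul_comm]
    · rw [ind_false hc, mul_zero, zero_mul, ite_self]
  rw [e4]

/-! ## 2. The core system holds -/

/-- The weights of the big vertices: `r t = cw m (insert m t)`; on small `t` this is `enc t + 2`. -/
theorem cw_insert {t : Finset ℕ} (ht : t ∈ smallSets m) : cw m (insert m t) = enc t + 2 := by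
  obtain ⟨htr, ht0⟩ := mem_smallSets.mp ht
  have hmT : m ∉ t := fun h => by have := Finset.mem_range.mp (htr h); omega
  have hne : insert m t ≠ {m} := fun h =>
    ht0 (Finset.subset_empty.mp (fun x hx => absurd (Finset.mem_singleton.mp ((h ▸ Finset.subset_insert m t) hx) ▸ hx) hmT))
  unfold cw
  rw [if_pos ⟨Finset.mem_insert_self m t, hne⟩, Finset.erase_insert hmT]

/-- **A vanishing combination of limit columns satisfies the core system** (with `gwu t = gvu ∅ t`). -/
theorem coreSys_of_vanishing (g : Finset ℕ → ℂ)
    (hg : ∀ (S T : Finset ℕ) (e : Bool), S ⊆ range (m + 1) → T ⊆ range m → ∑ E ∈ codeFaces m, g E * topCol m E (rowC m S e T) = 0) :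
    CoreSys m (fun t => (cw m (insert m t) : ℂ)) (g1 g) (g2 g) (fun t => gvu m g ∅ t) := by
  classical
  have hmr : ({m} : Finset ℕ) ⊆ range (m + 1) := Finset.singleton_subset_iff.mpr (Finset.mem_range.mpr (Nat.lt_succ_self m))
  have h0r : (∅ : Finset ℕ) ⊆ range (m + 1) := Finset.empty_subset _
  have hsmall : ∀ {t}, t ∈ smallSets m → t ⊆ range (m + 1) ∧ t ⊆ range m ∧ t ≠ ∅ ∧ m ∉ t ∧ t ≠ {m} := by
    intro t ht
    obtain ⟨htr, ht0⟩ := mem_smallSets.mp ht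
    have hmT : m ∉ t := fun h => by have := Finset.mem_range.mp (htr h); omega
    exact ⟨htr.trans (Finset.range_subset_range.mpr (Nat.le_succ m)), htr, ht0, hmT, fun h => hmT (h ▸ Finset.mem_singleton_self m)⟩
  have hins : ∀ {t}, t ∈ smallSets m → insert m t ⊆ range (m + 1) := fun ht =>
    Finset.insert_subset (Finset.mem_range.mpr (Nat.lt_succ_self m)) (hsmall ht).1
  -- the mixed coefficients vanish (R1c)
  have hvu : ∀ P ∈ cliqueSets m, P ≠ ∅ → ∀ t ∈ smallSets m, gvu m g P t = 0 := by
    intro P hP hP0 t ht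
    rw [← rowSum_R1c g (mem_cliqueSets.mp hP) hP0 ht]
    exact hg P t false (mem_cliqueSets.mp hP) (hsmall ht).2.1
  have halpha : ∀ {S T : Finset ℕ}, S ⊆ range (m + 1) → T ⊆ range m → _ := fun hS hT => (rowSum_alpha g hvu hS hT).symm.trans (hg _ _ true hS hT)
  refine ⟨g2_symm g, ?_, ?_, ?_, ?_, ?_, ?_, ?_, ?_, ?_, ?_⟩
  · intro s hs; rw [cw_insert hs, Nat.cast_ne_zero]; omega
  · intro s hs t ht hst heq
    rw [cw_insert hs, cw_insert ht] at heq
    have h' : enc s + 2 = enc t + 2 := by exact_mod_cast heq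
    exact hst (enc_injective (by omega))
  · -- h1 : persona rows (R1d) in `parts` form
    intro S hS hS0
    have h := hg S ∅ false hS (Finset.empty_subset _)
    rw [rowSum_R1d g hS hS0] at h
    rw [sum_parts_g2 g hS]
    linear_combination 2 * h
  · -- hα : row {α}
    have h := halpha h0r (Finset.empty_subset _)
    rw [ind_true ⟨rfl, rfl⟩, ind_false (fun h => h.2 rfl), ind_false (fun h => Finset.singleton_ne_empty m h.1.symm),
      ind_false (fun h => h.1 rfl), ind_false (fun h => h.1 rfl), ind_false (fun h => Finset.notMem_empty m h.1)] at h
    linear_combination h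
  · -- hαT : rows α ⊔ sh t
    intro t ht
    obtain ⟨-, htr, ht0, -, -⟩ := hsmall ht
    have h := halpha h0r htr
    rw [ind_false (fun h => ht0 h.2), ind_true ⟨rfl, ht0⟩, ind_false (fun h => Finset.singleton_ne_empty m h.1.symm),
      ind_false (fun h => h.1 rfl), ind_false (fun h => h.1 rfl), ind_false (fun h => Finset.notMem_empty m h.1)] at h
    linear_combination h
  · -- hαS : rows α ⊔ S, S ∉ {∅, {m}}
    intro S hS hS0 hSm
    have h := halpha hS (Finset.empty_subset _)
    rw [ind_false (fun h => hS0 h.1), ind_false (fun h => hS0 h.1), ind_false (fun h => h.2 rfl), ind_true ⟨hS0, rfl⟩,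
      ind_false (fun h => h.2 rfl), ind_false (fun h => h.2.2 rfl)] at h
    rw [g2_symm g ∅ S]
    linear_combination h
  · -- hαA : row α ⊔ {a*}
    have h := halpha hmr (Finset.empty_subset _)
    rw [ind_false (fun h => Finset.singleton_ne_empty m h.1), ind_false (fun h => Finset.singleton_ne_empty m h.1), ind_false (fun h => h.2 rfl),
      ind_true ⟨Finset.singleton_ne_empty m, rfl⟩, ind_false (fun h => h.2 rfl), ind_false (fun h => h.2.2 rfl)] at h
    rw [g2_symm g ∅ {m}]
    have hz : g2 g {m} {m} = 0 := by rw [g2, if_pos rfl]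
    linear_combination h - hz
  · -- hE : rows α ⊔ s ⊔ sh t
    intro s hs t ht
    obtain ⟨hsr, -, hs0, hms, hsm⟩ := hsmall hs
    obtain ⟨-, htr, ht0, -, -⟩ := hsmall ht
    have h := halpha hsr htr
    rw [ind_false (fun h => hs0 h.1), ind_false (fun h => hs0 h.1), ind_false (fun h => hsm h.1), ind_false (fun h => ht0 h.2),
      ind_true ⟨hs0, ht0⟩, ind_false (fun h => hms h.1)] at h
    have hst : (if t = s then (0 : ℂ) else g2 g s t) = g2 g s t := by
      by_cases hts : t = s
      · rw [if_pos hts, hts, g2, if_pos rfl]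
      · rw [if_neg hts]
    rw [hst, g2_symm g (insert m t) s, g2_symm g {m} s]
    linear_combination h
  · -- hF0 : rows α ⊔ {a*} ⊔ sh t
    intro t ht
    obtain ⟨-, htr, ht0, -, -⟩ := hsmall ht
    have h := halpha hmr htr
    rw [ind_false (fun h => Finset.singleton_ne_empty m h.1), ind_false (fun h => Finset.singleton_ne_empty m h.1), ind_true ⟨rfl, ht0⟩,
      ind_false (fun h => ht0 h.2), ind_true ⟨Finset.singleton_ne_empty m, ht0⟩,
      ind_false (fun h => h.2.1 (by rw [Finset.erase_singleton]))] at h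
    have hz : g2 g {m} {m} = 0 := by rw [g2, if_pos rfl]
    linear_combination h - hz
  · -- hFX : rows α ⊔ (X + a*) ⊔ sh t
    intro X hX t ht
    obtain ⟨hXr, -, hX0, hmX, -⟩ := hsmall hX
    obtain ⟨-, htr, ht0, -, -⟩ := hsmall ht
    have h := halpha (hins hX) htr
    have hne0 : insert m X ≠ ∅ := Finset.insert_ne_empty m X
    have hnem : insert m X ≠ {m} := fun h => hX0 (by
      have hsub : X ⊆ {m} := h ▸ Finset.subset_insert m X
      exact Finset.subset_empty.mp (fun x hx => absurd (Finset.mem_singleton.mp (hsub hx) ▸ hx) hmX))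
    rw [ind_false (fun h => hne0 h.1), ind_false (fun h => hne0 h.1), ind_false (fun h => hnem h.1), ind_false (fun h => ht0 h.2),
      ind_true ⟨hne0, ht0⟩, Finset.erase_insert hmX, ind_true ⟨Finset.mem_insert_self m X, hX0, ht0⟩] at h
    have hst : (if t = X then (0 : ℂ) else g2 g X t) = g2 g X t := by
      by_cases hts : t = X
      · rw [if_pos hts, hts, g2, if_pos rfl]
      · rw [if_neg hts]
    have hbig : (if t = X then (0 : ℂ) else (cw m (insert m t) : ℂ) * g2 g (insert m X) (insert m t)) =
        (cw m (insert m t) : ℂ) * g2 g (insert m X) (insert m t) := by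
      by_cases hts : t = X
      · rw [if_pos hts, hts, g2, if_pos rfl, mul_zero]
      · rw [if_neg hts]
    rw [hst, hbig]
    linear_combination h

/-- **THE LIMIT DESIGN IS A BASIS: a combination of the limit columns vanishing at every row is trivial.** -/
theorem topCol_indep (g : Finset ℕ → ℂ)
    (hg : ∀ (S T : Finset ℕ) (e : Bool), S ⊆ range (m + 1) → T ⊆ range m → ∑ E ∈ codeFaces m, g E * topCol m E (rowC m S e T) = 0) :
    ∀ E ∈ codeFaces m, g E = 0 := by
  classical
  obtain ⟨h1, h2, hwu⟩ := (coreSys_of_vanishing g hg).all_zero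
  have h0 : g ∅ = 0 := by rw [← rowSum_R1a g]; exact hg ∅ ∅ false (Finset.empty_subset _) (Finset.empty_subset _)
  have hu : ∀ t ∈ smallSets m, gu m g t = 0 := fun t ht => by
    rw [← rowSum_R1b g ht]; exact hg ∅ t false (Finset.empty_subset _) (mem_smallSets.mp ht).1
  have hvu : ∀ P ∈ cliqueSets m, ∀ t ∈ smallSets m, gvu m g P t = 0 := by
    intro P hP t ht
    by_cases hP0 : P = ∅
    · rw [hP0]; exact hwu t ht
    · rw [← rowSum_R1c g (mem_cliqueSets.mp hP) hP0 ht]; exact hg P t false (mem_cliqueSets.mp hP) (mem_smallSets.mp ht).1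
  intro E hE
  rcases codeFaces_cases hE with rfl | ⟨P, hP, rfl⟩ | ⟨t, ht, rfl⟩ | ⟨P, hP, P', hP', hlt, rfl⟩ | ⟨P, hP, t, ht, rfl⟩
  · exact h0
  · exact h1 P (mem_cliqueSets.mp hP)
  · exact hu t ht
  · have hne : P ≠ P' := fun h => lt_irrefl _ (h ▸ hlt)
    rw [← g2_of_ne g hne]
    exact h2 P P' (mem_cliqueSets.mp hP) (mem_cliqueSets.mp hP') hne
  · exact hvu P hP t ht

end SplitGeneral

end Summit.ValiantsHypothesis.ValiantsHypothesis.Theorems.BarrierLever.AnchoredPeeling
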